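import Mathlib
import Literature.Analysis.FluidPDE.VectorCalculus
import Literature.Analysis.FluidPDE.LeiZhang2011Proofs
import Summits.NavierStokesRegularity.NavierStokesRegularity.Theorems.FilamentSkeletonRssSkeletonEquilibriumLiaCrossExpansion
import Summits.NavierStokesRegularity.NavierStokesRegularity.Theorems.FilamentSkeletonRssSkeletonEquilibriumSelfInductionTail
import Summits.NavierStokesRegularity.NavierStokesRegularity.Theorems.FilamentSkeletonRssSkeletonEquilibriumKernelPerturbation
import Summits.NavierStokesRegularity.NavierStokesRegularity.Theorems.FilamentSkeletonRssSkeletonEquilibriumRosenheadMoments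
import Summits.NavierStokesRegularity.NavierStokesRegularity.Theorems.FilamentSkeletonRssSkeletonEquilibriumRosenheadMomentBounds

/-!
# The `e`-uniform local-induction (LIA) window assembly of the regularised self-induction

Tools stub `stub_liaWindowAssembly` of line `zero-accretion-selection` (crux `SkeletonEquilibrium`,
thesis `FilamentSkeletonRss`). In `X`-units with core `e ∈ (0, δ]`, the self-induced velocity of a
filament `X : ℝ → ℝ³` at `X t` under the Rosenhead-regularised Biot–Savart law is
`S_e[X](t) = ∫ K_e(X t − X u) • X′(u) × (X t − X u) du`, `K_e(r) = (‖r‖² + e²)^{-3/2}`.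
For a unit-speed `C^{2,1}` curve (`‖X′‖ ≡ 1`, `‖X″‖ ≤ κ₀`, `X″` `H`-Lipschitz) which is chord-arc from
`t` (`c |u − t| ≤ ‖X u − X t‖`) we prove the `e`-UNIFORM quantitative local-induction asymptotics
with the EXACT Rosenhead coefficient: the integrand is integrable on `ℝ` and
`‖S_e[X](t) − (arsinh(δ/e) − δ/√(δ²+e²)) • X′(t) × X″(t)‖ ≤ C(c, H, κ₀, δ)`, `C` independent of
`e`, `X`, `t`.

Proof (assembly of the landed `Sketch` bricks). Split `ℝ` into the tail `{δ ≤ |u − t|}`, where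
`stub_selfInductionTail` (p137835) gives integrability and the bound `2/(c²δ)`, and the window
`(t − δ, t + δ)`, where the integrand is continuous. On the window subtract the model term
`P(u) = (K_e(s) s²/2) • T × N` (`s = u − t`, `T = X′(t)`, `N = X″(t)`), whose integral is EXACTLY
`(arsinh(δ/e) − δ/√(δ²+e²)) • T × N` by the second Rosenhead moment (`stub_rosenheadMoments`,
p136576). The remainder is bounded POINTWISE by an `e`-free constant `M(c, H, κ₀)`: for
`|s| ≤ δ₀ = 1/(2c₁+2)`, `c₁ = κ₀²/4 + 2H + κ₀H + H²`, the Taylor brick `stub_liaCrossExpansion`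
(p137771) (fed with the `C^{2,1}` Taylor remainders obtained from the mean value inequality and
`⟪T, N⟫ = 0` from `‖X′‖ ≡ 1`), the kernel perturbation estimate `stub_kernelPerturbation`
(p137683) and `|s|³ K_e(s) ≤ 1` (`stub_rosenheadMomentBounds`, p136731) bound it by
`2H + (3/2)κ₀H + H² + 9c₁`; for `|s| > δ₀` the crude bounds `K_e(‖z‖) ‖z‖ ≤ ‖z‖⁻² ≤ (cδ₀)⁻²`
(chord-arc) and `K_e(s) s²/2 · κ₀ ≤ κ₀/(2δ₀)` apply. Hence `C = 2/(c²δ) + 2δ M`.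
-/

noncomputable section

open MeasureTheory Filter Topology Set
open Literature.Analysis.FluidPDE

namespace Summit.NavierStokesRegularity.NavierStokesRegularity.Theorems.SkeletonEquilibrium.ZeroAccretionSelection
set_option linter.dupNamespace false

open Summit.NavierStokesRegularity.NavierStokesRegularity.Theorems.SkeletonEquilibrium.Sketch

/-- `b ^ (3/2) = b √b` for `0 < b`. [folklore] -/
private theorem lwa_rpow_three_halves {b : ℝ} (hb : 0 < b) :
    b ^ (3 / 2 : ℝ) = b * Real.sqrt b := by
  -- adapted from FilamentSkeletonRssSkeletonEquilibriumSelfInductionTail (sit_rpow_three_halves)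
  rw [show (3 / 2 : ℝ) = 1 + 1 / 2 by norm_num, Real.rpow_add hb, Real.rpow_one, Real.sqrt_eq_rpow]

/-- The `e`-uniform scalar kernel bound `((r² + e²)^{3/2})⁻¹ r ≤ (r²)⁻¹` for `0 < r`. [folklore] -/
private theorem lwa_kernel_mul_le_inv_sq {r : ℝ} (hr : 0 < r) (e : ℝ) :
    ((r ^ 2 + e ^ 2) ^ (3 / 2 : ℝ))⁻¹ * r ≤ (r ^ 2)⁻¹ := by
  -- adapted from FilamentSkeletonRssSkeletonEquilibriumSelfInductionTail (sit_kernel_mul_le_inv_sq)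
  have hb : 0 < r ^ 2 + e ^ 2 := by positivity
  have hs : 0 < Real.sqrt (r ^ 2 + e ^ 2) := Real.sqrt_pos.2 hb
  have h1 : r ^ 2 ≤ r ^ 2 + e ^ 2 := by nlinarith [sq_nonneg e]
  have h2 : r ≤ Real.sqrt (r ^ 2 + e ^ 2) := Real.le_sqrt_of_sq_le h1
  rw [lwa_rpow_three_halves hb, inv_mul_le_iff₀ (mul_pos hb hs), le_mul_inv_iff₀ (pow_pos hr 2)]
  calc r * r ^ 2 = r ^ 2 * r := mul_comm _ _
    _ ≤ (r ^ 2 + e ^ 2) * Real.sqrt (r ^ 2 + e ^ 2) := mul_le_mul h1 h2 hr.le hb.le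

/-- `⟪X′(t), X″(t)⟫ = 0` along a unit-speed `C²` curve (differentiate `‖X′‖² ≡ 1`). [folklore] -/
private theorem lwa_inner_eq_zero {X : ℝ → EuclideanSpace ℝ (Fin 3)} (hX : ContDiff ℝ 2 X)
    (hT1 : ∀ u, ‖deriv X u‖ = 1) (t : ℝ) : inner ℝ (deriv X t) (deriv (deriv X) t) = 0 := by
  -- adapted from `strain_identity` in Theorems/SkeletonEquilibrium/Negative/StrainIdentity.lean
  have hTd : Differentiable ℝ (deriv X) := hX.differentiable_deriv_two
  have h1 : (fun σ => inner ℝ (deriv X σ) (deriv X σ)) = fun _ => (1 : ℝ) := by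
    funext σ; rw [real_inner_self_eq_norm_sq, hT1 σ, one_pow]
  have h2 : HasDerivAt (fun σ => inner ℝ (deriv X σ) (deriv X σ))
      (inner ℝ (deriv X t) (deriv (deriv X) t) + inner ℝ (deriv (deriv X) t) (deriv X t)) t :=
    (hTd t).hasDerivAt.inner ℝ (hTd t).hasDerivAt
  rw [h1] at h2
  have h3 := h2.unique (hasDerivAt_const t (1 : ℝ))
  rw [real_inner_comm (deriv (deriv X) t)] at h3 ⊢
  linarith

/-- Chord ≤ arclength for a unit-speed `C²` curve: `‖X u − X t‖ ≤ |u − t|`. [folklore] -/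
private theorem lwa_chord_le {X : ℝ → EuclideanSpace ℝ (Fin 3)} (hX : ContDiff ℝ 2 X)
    (hT1 : ∀ u, ‖deriv X u‖ = 1) (t u : ℝ) : ‖X u - X t‖ ≤ |u - t| := by
  have hXd : Differentiable ℝ X := hX.differentiable (by norm_num)
  have h := Convex.norm_image_sub_le_of_norm_deriv_le (f := X) (C := 1) (s := Set.univ)
    (fun x _ => hXd x) (fun x _ => (hT1 x).le) convex_univ (Set.mem_univ t) (Set.mem_univ u)
  rwa [one_mul, Real.norm_eq_abs] at h

/-- First-order Taylor remainder of the tangent of a `C^{2,1}` curve: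
`‖X′(u) − X′(t) − (u − t) X″(t)‖ ≤ H (u − t)²` (mean value inequality applied to
`r ↦ X′(r) − X′(t) − (r − t) X″(t)`, whose derivative `X″(r) − X″(t)` has norm `≤ H |u − t|`
between `t` and `u`). [folklore] -/
private theorem lwa_tangent_remainder {X : ℝ → EuclideanSpace ℝ (Fin 3)} {H : ℝ}
    (hX : ContDiff ℝ 2 X) (hH : 0 ≤ H)
    (hLip : ∀ u v, ‖deriv (deriv X) u - deriv (deriv X) v‖ ≤ H * |u - v|) (t u : ℝ) :
    ‖deriv X u - deriv X t - (u - t) • deriv (deriv X) t‖ ≤ H * (u - t) ^ 2 := by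
  have hTd : Differentiable ℝ (deriv X) := hX.differentiable_deriv_two
  have hφ : ∀ r, HasDerivAt (fun r => deriv X r - deriv X t - (r - t) • deriv (deriv X) t)
      (deriv (deriv X) r - deriv (deriv X) t) r := fun r => by
    have h2 : HasDerivAt (fun r : ℝ => (r - t) • deriv (deriv X) t)
        ((1 : ℝ) • deriv (deriv X) t) r := ((hasDerivAt_id' r).sub_const t).smul_const _
    rw [one_smul] at h2
    exact ((hTd r).hasDerivAt.sub_const _).sub h2
  have hbound : ∀ r ∈ Set.uIcc t u, ‖deriv (deriv X) r - deriv (deriv X) t‖ ≤ H * |u - t| :=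
    fun r hr => (hLip r t).trans (mul_le_mul_of_nonneg_left (Set.abs_sub_left_of_mem_uIcc hr) hH)
  have hmvt := (convex_uIcc t u).norm_image_sub_le_of_norm_hasDerivWithin_le
    (fun r _ => (hφ r).hasDerivWithinAt) hbound Set.left_mem_uIcc Set.right_mem_uIcc
  have h0 : deriv X t - deriv X t - (t - t) • deriv (deriv X) t = 0 := by simp
  rw [h0, sub_zero, Real.norm_eq_abs] at hmvt
  calc ‖deriv X u - deriv X t - (u - t) • deriv (deriv X) t‖ ≤ H * |u - t| * |u - t| := hmvt
    _ = H * (u - t) ^ 2 := by rw [mul_assoc, abs_mul_abs_self, pow_two]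

/-- Second-order Taylor remainder of a `C^{2,1}` curve:
`‖X(u) − X(t) − (u − t) X′(t) − ((u − t)²/2) X″(t)‖ ≤ H |u − t|³` (mean value inequality applied
to `r ↦ X(r) − X(t) − (r − t) X′(t) − ((r − t)²/2) X″(t)`, whose derivative is the first-order
tangent remainder, of norm `≤ H (u − t)²` between `t` and `u`). [folklore] -/
private theorem lwa_chord_remainder {X : ℝ → EuclideanSpace ℝ (Fin 3)} {H : ℝ}
    (hX : ContDiff ℝ 2 X) (hH : 0 ≤ H)
    (hLip : ∀ u v, ‖deriv (deriv X) u - deriv (deriv X) v‖ ≤ H * |u - v|) (t u : ℝ) :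
    ‖X u - X t - (u - t) • deriv X t - ((u - t) ^ 2 / 2) • deriv (deriv X) t‖ ≤
      H * |u - t| ^ 3 := by
  have hXd : Differentiable ℝ X := hX.differentiable (by norm_num)
  have hψ : ∀ r, HasDerivAt
      (fun r => X r - X t - (r - t) • deriv X t - ((r - t) ^ 2 / 2) • deriv (deriv X) t)
      (deriv X r - deriv X t - (r - t) • deriv (deriv X) t) r := fun r => by
    have h2 : HasDerivAt (fun r : ℝ => (r - t) • deriv X t) ((1 : ℝ) • deriv X t) r :=
      ((hasDerivAt_id' r).sub_const t).smul_const _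
    rw [one_smul] at h2
    have h3 : HasDerivAt (fun r : ℝ => (r - t) ^ 2 / 2) (r - t) r := by
      refine ((((hasDerivAt_id' r).sub_const t).fun_pow 2).div_const 2).congr_deriv ?_
      norm_num
    exact (((hXd r).hasDerivAt.sub_const _).sub h2).sub (h3.smul_const _)
  have hbound : ∀ r ∈ Set.uIcc t u,
      ‖deriv X r - deriv X t - (r - t) • deriv (deriv X) t‖ ≤ H * (u - t) ^ 2 := fun r hr => by
    refine (lwa_tangent_remainder hX hH hLip t r).trans (mul_le_mul_of_nonneg_left ?_ hH)
    rw [← sq_abs (r - t), ← sq_abs (u - t)]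
    exact pow_le_pow_left₀ (abs_nonneg _) (Set.abs_sub_left_of_mem_uIcc hr) 2
  have hmvt := (convex_uIcc t u).norm_image_sub_le_of_norm_hasDerivWithin_le
    (fun r _ => (hψ r).hasDerivWithinAt) hbound Set.left_mem_uIcc Set.right_mem_uIcc
  have h0 : X t - X t - (t - t) • deriv X t - ((t - t) ^ 2 / 2) • deriv (deriv X) t = 0 := by simp
  rw [h0, sub_zero, Real.norm_eq_abs] at hmvt
  calc ‖X u - X t - (u - t) • deriv X t - ((u - t) ^ 2 / 2) • deriv (deriv X) t‖
      ≤ H * (u - t) ^ 2 * |u - t| := hmvt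
    _ = H * |u - t| ^ 3 := by rw [← sq_abs]; ring

/-- **The pointwise `e`-uniform bound on the window remainder.** For a unit vector `T`, `N` with
`‖N‖ ≤ κ₀`, `⟪T, N⟫ = 0`, a unit "tangent" `a` and a "chord" `z` at parameter distance `s` with the
`C^{2,1}` Taylor remainders `‖a − T − sN‖ ≤ H s²`, `‖z − sT − (s²/2)N‖ ≤ H |s|³`, chord ≤ arclength
`‖z‖ ≤ |s|` and the chord-arc bound `c |s| ≤ ‖z‖`, the regularised Biot–Savart integrand at
`w = −z` differs from the local-induction model term `(K_e(s) s²/2) • T × N` by at most the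
`e`-free constant `(2H + (3/2)κ₀H + H² + 9c₁) + ((2c₁+2)²/c² + κ₀(c₁+1))`,
`c₁ = κ₀²/4 + 2H + κ₀H + H²`. [folklore] -/
private theorem lwa_pointwise {s e H κ₀ c : ℝ} {T N a z w : EuclideanSpace ℝ (Fin 3)}
    (he : 0 < e) (hH : 0 ≤ H) (hκ : 0 ≤ κ₀) (hc : 0 < c)
    (hT : ‖T‖ = 1) (hN : ‖N‖ ≤ κ₀) (hTN : inner ℝ T N = 0) (ha : ‖a‖ = 1)
    (hr₁ : ‖a - T - s • N‖ ≤ H * s ^ 2) (hr₂ : ‖z - s • T - (s ^ 2 / 2) • N‖ ≤ H * |s| ^ 3)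
    (hzs : ‖z‖ ≤ |s|) (hcz : c * |s| ≤ ‖z‖) (hw : w = -z) :
    ‖((‖w‖ ^ 2 + e ^ 2) ^ (3 / 2 : ℝ))⁻¹ • cross a w -
        (((s ^ 2 + e ^ 2) ^ (3 / 2 : ℝ))⁻¹ * (s ^ 2 / 2)) • cross T N‖ ≤
      (2 * H + 3 / 2 * κ₀ * H + H ^ 2 + 9 * (κ₀ ^ 2 / 4 + 2 * H + κ₀ * H + H ^ 2)) +
        ((2 * (κ₀ ^ 2 / 4 + 2 * H + κ₀ * H + H ^ 2) + 2) ^ 2 / c ^ 2 +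
          κ₀ * (κ₀ ^ 2 / 4 + 2 * H + κ₀ * H + H ^ 2 + 1)) := by
  subst hw
  rw [norm_neg]
  set c₁ : ℝ := κ₀ ^ 2 / 4 + 2 * H + κ₀ * H + H ^ 2 with hc₁
  set K₀ : ℝ := ((s ^ 2 + e ^ 2) ^ (3 / 2 : ℝ))⁻¹ with hK₀
  set Kz : ℝ := ((‖z‖ ^ 2 + e ^ 2) ^ (3 / 2 : ℝ))⁻¹ with hKz
  have hc₁0 : 0 ≤ c₁ := by rw [hc₁]; positivity
  have hq₀ : 0 < s ^ 2 + e ^ 2 := by positivity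
  have hK₀0 : 0 ≤ K₀ := inv_nonneg.2 (Real.rpow_nonneg hq₀.le _)
  have hKz0 : 0 ≤ Kz := inv_nonneg.2 (Real.rpow_nonneg (by positivity) _)
  have hσ0 : 0 ≤ |s| := abs_nonneg s
  have hs2 : s ^ 2 = |s| ^ 2 := (sq_abs s).symm
  have hTNn : ‖cross T N‖ ≤ κ₀ := by
    calc ‖cross T N‖ ≤ ‖T‖ * ‖N‖ := norm_cross_le_norm_mul_norm T N
      _ ≤ 1 * κ₀ := by rw [hT]; exact mul_le_mul_of_nonneg_left hN zero_le_one
      _ = κ₀ := one_mul κ₀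
  have hazn : ‖cross a (-z)‖ ≤ ‖z‖ := by
    calc ‖cross a (-z)‖ ≤ ‖a‖ * ‖-z‖ := norm_cross_le_norm_mul_norm a (-z)
      _ = ‖z‖ := by rw [ha, one_mul, norm_neg]
  have hM₁ : 0 ≤ 2 * H + 3 / 2 * κ₀ * H + H ^ 2 + 9 * c₁ := by positivity
  have hM₂ : 0 ≤ (2 * c₁ + 2) ^ 2 / c ^ 2 + κ₀ * (c₁ + 1) := by positivity
  have hcubic : |s| ^ 3 * K₀ ≤ 1 := stub_rosenheadMomentBounds.1 e s he
  have hd0 : 0 < 2 * c₁ + 2 := by positivity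
  rcases le_or_gt |s| (1 / (2 * c₁ + 2)) with hs | hs
  · -- inside the Taylor window `|s| ≤ δ₀ = 1/(2c₁+2)`
    have hs1 : |s| ≤ 1 := hs.trans (by rw [div_le_one hd0]; linarith only [hc₁0])
    obtain ⟨h1, h2⟩ := stub_liaCrossExpansion s H κ₀ T N a z hH hκ hT hN hTN hr₁ hr₂
    have hp43 : |s| ^ 4 ≤ |s| ^ 3 := pow_le_pow_of_le_one hσ0 hs1 (by norm_num)
    have hp53 : |s| ^ 5 ≤ |s| ^ 3 := pow_le_pow_of_le_one hσ0 hs1 (by norm_num)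
    have hp54 : |s| ^ 5 ≤ |s| ^ 4 := pow_le_pow_of_le_one hσ0 hs1 (by norm_num)
    have hp64 : |s| ^ 6 ≤ |s| ^ 4 := pow_le_pow_of_le_one hσ0 hs1 (by norm_num)
    have hs4 : s ^ 4 = |s| ^ 4 := (Even.pow_abs (by decide) s).symm
    have hs6 : s ^ 6 = |s| ^ 6 := (Even.pow_abs (by decide) s).symm
    have hB₁ : 2 * H * |s| ^ 3 + 3 / 2 * κ₀ * H * s ^ 4 + H ^ 2 * |s| ^ 5 ≤
        (2 * H + 3 / 2 * κ₀ * H + H ^ 2) * |s| ^ 3 := by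
      rw [hs4]
      have e1 := mul_le_mul_of_nonneg_left hp43 (by positivity : (0 : ℝ) ≤ 3 / 2 * κ₀ * H)
      have e2 := mul_le_mul_of_nonneg_left hp53 (by positivity : (0 : ℝ) ≤ H ^ 2)
      linarith only [e1, e2]
    have hρ : |‖z‖ ^ 2 - s ^ 2| ≤ c₁ * |s| ^ 4 := by
      refine h2.trans ?_
      rw [hs4, hs6, hc₁]
      have e3 := mul_le_mul_of_nonneg_left hp54 (by positivity : (0 : ℝ) ≤ κ₀ * H)
      have e4 := mul_le_mul_of_nonneg_left hp64 (by positivity : (0 : ℝ) ≤ H ^ 2)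
      linarith only [e3, e4]
    -- the perturbation of the squared chord is at most half the regularised squared chord
    have hsmall : c₁ * |s| ^ 2 ≤ 1 / 2 := by
      have h' : |s| ^ 2 ≤ (1 / (2 * c₁ + 2)) ^ 2 := pow_le_pow_left₀ hσ0 hs 2
      calc c₁ * |s| ^ 2 ≤ c₁ * (1 / (2 * c₁ + 2)) ^ 2 := mul_le_mul_of_nonneg_left h' hc₁0
        _ ≤ 1 / 2 := by
          rw [div_pow, one_pow, mul_one_div, div_le_div_iff₀ (pow_pos hd0 2) (by norm_num)]
          nlinarith only [hc₁0, sq_nonneg c₁]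
    have hρ' : |‖z‖ ^ 2 - s ^ 2| ≤ (s ^ 2 + e ^ 2) / 2 := by
      refine hρ.trans ?_
      have hA : c₁ * |s| ^ 4 ≤ 1 / 2 * |s| ^ 2 := by
        rw [show c₁ * |s| ^ 4 = (c₁ * |s| ^ 2) * |s| ^ 2 by ring]
        exact mul_le_mul_of_nonneg_right hsmall (pow_nonneg hσ0 2)
      have hB : 1 / 2 * |s| ^ 2 ≤ (s ^ 2 + e ^ 2) / 2 := by
        rw [← hs2]
        linarith only [sq_nonneg e]
      exact hA.trans hB
    have hpert := stub_kernelPerturbation (s ^ 2 + e ^ 2) (‖z‖ ^ 2 - s ^ 2) hq₀ hρ'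
    rw [show s ^ 2 + e ^ 2 + (‖z‖ ^ 2 - s ^ 2) = ‖z‖ ^ 2 + e ^ 2 by ring] at hpert
    have hQ : 0 < (s ^ 2 + e ^ 2) ^ (5 / 2 : ℝ) := Real.rpow_pos_of_pos hq₀ _
    have h5 : |s| ^ 5 ≤ (s ^ 2 + e ^ 2) ^ (5 / 2 : ℝ) := by
      rw [Real.rpow_div_two_eq_sqrt 5 hq₀.le, Real.rpow_ofNat]
      exact pow_le_pow_left₀ hσ0 (Real.abs_le_sqrt (le_add_of_nonneg_right (sq_nonneg e))) 5
    -- decomposition of the remainder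
    have hdec : Kz • cross a (-z) - (K₀ * (s ^ 2 / 2)) • cross T N =
        K₀ • (cross a (-z) - (s ^ 2 / 2) • cross T N) + (Kz - K₀) • cross a (-z) := by
      rw [smul_sub, smul_smul, sub_smul]; abel
    rw [hdec]
    have hI : ‖K₀ • (cross a (-z) - (s ^ 2 / 2) • cross T N)‖ ≤
        2 * H + 3 / 2 * κ₀ * H + H ^ 2 := by
      rw [norm_smul, Real.norm_of_nonneg hK₀0]
      calc K₀ * ‖cross a (-z) - (s ^ 2 / 2) • cross T N‖
          ≤ K₀ * ((2 * H + 3 / 2 * κ₀ * H + H ^ 2) * |s| ^ 3) :=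
            mul_le_mul_of_nonneg_left (h1.trans hB₁) hK₀0
        _ = (2 * H + 3 / 2 * κ₀ * H + H ^ 2) * (|s| ^ 3 * K₀) := by ring
        _ ≤ (2 * H + 3 / 2 * κ₀ * H + H ^ 2) * 1 :=
            mul_le_mul_of_nonneg_left hcubic (by positivity)
        _ = 2 * H + 3 / 2 * κ₀ * H + H ^ 2 := mul_one _
    have hII : ‖(Kz - K₀) • cross a (-z)‖ ≤ 9 * c₁ := by
      rw [norm_smul, Real.norm_eq_abs]
      calc |Kz - K₀| * ‖cross a (-z)‖
          ≤ (9 * |‖z‖ ^ 2 - s ^ 2| / (s ^ 2 + e ^ 2) ^ (5 / 2 : ℝ)) * |s| :=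
            mul_le_mul hpert (hazn.trans hzs) (norm_nonneg _) (by positivity)
        _ ≤ (9 * (c₁ * |s| ^ 4) / (s ^ 2 + e ^ 2) ^ (5 / 2 : ℝ)) * |s| := by gcongr
        _ = 9 * c₁ * (|s| ^ 5 / (s ^ 2 + e ^ 2) ^ (5 / 2 : ℝ)) := by ring
        _ ≤ 9 * c₁ * 1 := mul_le_mul_of_nonneg_left ((div_le_one hQ).2 h5) (by positivity)
        _ = 9 * c₁ := mul_one _
    calc ‖K₀ • (cross a (-z) - (s ^ 2 / 2) • cross T N) + (Kz - K₀) • cross a (-z)‖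
        ≤ (2 * H + 3 / 2 * κ₀ * H + H ^ 2) + 9 * c₁ := norm_add_le_of_le hI hII
      _ ≤ (2 * H + 3 / 2 * κ₀ * H + H ^ 2 + 9 * c₁) +
            ((2 * c₁ + 2) ^ 2 / c ^ 2 + κ₀ * (c₁ + 1)) := le_add_of_nonneg_right hM₂
  · -- outside the Taylor window: crude `e`-free bounds from the chord-arc property
    have hσpos : 0 < |s| := lt_of_le_of_lt (div_pos one_pos hd0).le hs
    have hzpos : 0 < ‖z‖ := lt_of_lt_of_le (mul_pos hc hσpos) hcz
    have hI : ‖Kz • cross a (-z)‖ ≤ (2 * c₁ + 2) ^ 2 / c ^ 2 := by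
      rw [norm_smul, Real.norm_of_nonneg hKz0]
      calc Kz * ‖cross a (-z)‖ ≤ Kz * ‖z‖ := mul_le_mul_of_nonneg_left hazn hKz0
        _ ≤ (‖z‖ ^ 2)⁻¹ := lwa_kernel_mul_le_inv_sq hzpos e
        _ ≤ ((c * |s|) ^ 2)⁻¹ :=
            inv_anti₀ (pow_pos (mul_pos hc hσpos) 2) (pow_le_pow_left₀ (by positivity) hcz 2)
        _ ≤ ((c * (1 / (2 * c₁ + 2))) ^ 2)⁻¹ :=
            inv_anti₀ (pow_pos (mul_pos hc (div_pos one_pos hd0)) 2)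
              (pow_le_pow_left₀ (by positivity) (mul_le_mul_of_nonneg_left hs.le hc.le) 2)
        _ = (2 * c₁ + 2) ^ 2 / c ^ 2 := by rw [mul_one_div, div_pow, inv_div]
    have hII : ‖(K₀ * (s ^ 2 / 2)) • cross T N‖ ≤ κ₀ * (c₁ + 1) := by
      rw [norm_smul, Real.norm_of_nonneg (mul_nonneg hK₀0 (by positivity : (0 : ℝ) ≤ s ^ 2 / 2))]
      have hK₀s : K₀ * s ^ 2 ≤ 1 / |s| := by
        rw [le_div_iff₀ hσpos, hs2]
        calc K₀ * |s| ^ 2 * |s| = |s| ^ 3 * K₀ := by ring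
          _ ≤ 1 := hcubic
      have hinv : 1 / |s| ≤ 2 * c₁ + 2 := by
        rw [div_le_iff₀ hσpos]
        have := (div_lt_iff₀ hd0).1 hs
        linarith only [this]
      calc K₀ * (s ^ 2 / 2) * ‖cross T N‖ ≤ K₀ * (s ^ 2 / 2) * κ₀ :=
            mul_le_mul_of_nonneg_left hTNn (mul_nonneg hK₀0 (by positivity))
        _ = (K₀ * s ^ 2) * κ₀ / 2 := by ring
        _ ≤ (2 * c₁ + 2) * κ₀ / 2 := by gcongr; exact hK₀s.trans hinv
        _ = κ₀ * (c₁ + 1) := by ring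
    calc ‖Kz • cross a (-z) - (K₀ * (s ^ 2 / 2)) • cross T N‖
        ≤ (2 * c₁ + 2) ^ 2 / c ^ 2 + κ₀ * (c₁ + 1) := norm_sub_le_of_le hI hII
      _ ≤ (2 * H + 3 / 2 * κ₀ * H + H ^ 2 + 9 * c₁) +
            ((2 * c₁ + 2) ^ 2 / c ^ 2 + κ₀ * (c₁ + 1)) := le_add_of_nonneg_left hM₁

/-- **Tools stub** (`stub_liaWindowAssembly`): the `e`-uniform local-induction (LIA) window
assembly. For `c > 0`, `H, κ₀ ≥ 0`, `δ > 0` there is `C = C(c, H, κ₀, δ) ≥ 0` such that for every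
core `e ∈ (0, δ]`, every `C²` curve `X : ℝ → ℝ³` with `‖X′‖ ≡ 1`, `‖X″‖ ≤ κ₀`, `X″` `H`-Lipschitz and
chord-arc from `t` (`c |u − t| ≤ ‖X u − X t‖`), the regularised self-induction integrand
`u ↦ ((‖X t − X u‖² + e²)^{3/2})⁻¹ • X′(u) × (X t − X u)` is integrable on `ℝ` and its integral is
`(arsinh(δ/e) − δ/√(δ² + e²)) • X′(t) × X″(t)` up to an error of norm at most `C`
(explicitly `C = 2/(c²δ) + 2δ M(c, H, κ₀)`). [folklore] -/
theorem stub_liaWindowAssembly :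
    ∀ (c H κ₀ δ : ℝ), 0 < c → 0 ≤ H → 0 ≤ κ₀ → 0 < δ → ∃ C : ℝ, 0 ≤ C ∧ ∀ (e : ℝ), 0 < e → e ≤ δ →
      ∀ (X : ℝ → EuclideanSpace ℝ (Fin 3)) (t : ℝ), ContDiff ℝ 2 X → (∀ u, ‖deriv X u‖ = 1) →
        (∀ u, ‖deriv (deriv X) u‖ ≤ κ₀) → (∀ u v, ‖deriv (deriv X) u - deriv (deriv X) v‖ ≤ H * |u - v|) →
        (∀ u, c * |u - t| ≤ ‖X u - X t‖) →
        Integrable (fun u : ℝ => ((‖X t - X u‖ ^ 2 + e ^ 2) ^ (3 / 2 : ℝ))⁻¹ • cross (deriv X u) (X t - X u)) ∧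
        ‖(∫ u : ℝ, ((‖X t - X u‖ ^ 2 + e ^ 2) ^ (3 / 2 : ℝ))⁻¹ • cross (deriv X u) (X t - X u)) -
          (Real.arsinh (δ / e) - δ / Real.sqrt (δ ^ 2 + e ^ 2)) • cross (deriv X t) (deriv (deriv X) t)‖ ≤ C := by
  intro c H κ₀ δ hc hH hκ hδ
  -- the `e`-free pointwise constant of `lwa_pointwise`
  set M : ℝ := (2 * H + 3 / 2 * κ₀ * H + H ^ 2 + 9 * (κ₀ ^ 2 / 4 + 2 * H + κ₀ * H + H ^ 2)) +
      ((2 * (κ₀ ^ 2 / 4 + 2 * H + κ₀ * H + H ^ 2) + 2) ^ 2 / c ^ 2 +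
        κ₀ * (κ₀ ^ 2 / 4 + 2 * H + κ₀ * H + H ^ 2 + 1)) with hM
  have hM0 : 0 ≤ M := by rw [hM]; positivity
  refine ⟨2 / (c ^ 2 * δ) + M * (2 * δ), add_nonneg (by positivity) (mul_nonneg hM0 (by positivity)), ?_⟩
  intro e he _heδ X t hX hT1 hκ₀ hLip hchord
  -- the integrand and its continuity
  set F : ℝ → EuclideanSpace ℝ (Fin 3) := fun u =>
    ((‖X t - X u‖ ^ 2 + e ^ 2) ^ (3 / 2 : ℝ))⁻¹ • cross (deriv X u) (X t - X u)
  have hX1 : ContDiff ℝ 1 X := hX.of_le (by norm_num)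
  have hXc : Continuous X := hX.continuous
  have hdc : Continuous (deriv X) := hX.continuous_deriv (by norm_num)
  have hb : ∀ u : ℝ, 0 < ‖X t - X u‖ ^ 2 + e ^ 2 := fun u => by positivity
  have hsc : Continuous fun u : ℝ => ((‖X t - X u‖ ^ 2 + e ^ 2) ^ (3 / 2 : ℝ))⁻¹ :=
    ((((continuous_const.sub hXc).norm.pow 2).add continuous_const).rpow_const
      fun u => Or.inr (by norm_num)).inv₀ fun u => (Real.rpow_pos_of_pos (hb u) _).ne'
  have hcr : Continuous fun u : ℝ => cross (deriv X u) (X t - X u) :=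
    (crossCLM.continuous.comp hdc).clm_apply (continuous_const.sub hXc)
  have hcont : Continuous F := hsc.smul hcr
  -- the tail (brick `stub_selfInductionTail`)
  obtain ⟨htailI, htailB⟩ :=
    stub_selfInductionTail e c δ X t he.ne' hc hδ hX1 (fun u => (hT1 u).le) hchord
  -- the window is the complement of the tail
  have hSm : MeasurableSet {u : ℝ | δ ≤ |u - t|} :=
    (isClosed_le continuous_const
      (continuous_abs.comp (continuous_id.sub continuous_const))).measurableSet
  have hSc : {u : ℝ | δ ≤ |u - t|}ᶜ = Set.Ioo (t - δ) (t + δ) := by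
    ext u
    simp only [Set.mem_compl_iff, Set.mem_setOf_eq, not_le, Set.mem_Ioo, abs_sub_lt_iff]
    constructor <;> rintro ⟨h1, h2⟩ <;> constructor <;> linarith
  have hwinI : IntegrableOn F {u : ℝ | δ ≤ |u - t|}ᶜ := by
    rw [hSc]
    exact hcont.integrableOn_Icc.mono_set Set.Ioo_subset_Icc_self
  have hInt : Integrable F := by
    have h := integrableOn_union.2 ⟨htailI, hwinI⟩
    rwa [Set.union_compl_self, integrableOn_univ] at h
  refine ⟨hInt, ?_⟩
  -- the local-induction model term on the window
  set P : ℝ → EuclideanSpace ℝ (Fin 3) := fun u =>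
    ((((u - t) ^ 2 + e ^ 2) ^ (3 / 2 : ℝ))⁻¹ * ((u - t) ^ 2 / 2)) •
      cross (deriv X t) (deriv (deriv X) t) with hP
  have hKc : Continuous fun u : ℝ => (((u - t) ^ 2 + e ^ 2) ^ (3 / 2 : ℝ))⁻¹ :=
    ((((continuous_id.sub continuous_const).pow 2).add continuous_const).rpow_const
      fun _ => Or.inr (by norm_num)).inv₀
      fun u => (Real.rpow_pos_of_pos (by positivity : (0 : ℝ) < (u - t) ^ 2 + e ^ 2) _).ne'
  have hPc : Continuous P :=
    (hKc.mul (((continuous_id.sub continuous_const).pow 2).div_const 2)).smul continuous_const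
  -- the pointwise `e`-uniform bound on the window remainder
  have hptw : ∀ u, ‖F u - P u‖ ≤ M := fun u => by
    rw [hM]
    exact lwa_pointwise he hH hκ hc (hT1 t) (hκ₀ t) (lwa_inner_eq_zero hX hT1 t) (hT1 u)
      (lwa_tangent_remainder hX hH hLip t u) (lwa_chord_remainder hX hH hLip t u)
      (lwa_chord_le hX hT1 t u) (hchord u) (neg_sub (X u) (X t)).symm
  -- the model term integrates exactly to the Rosenhead coefficient (brick `stub_rosenheadMoments`)
  have hPint : ∫ u in (t - δ)..(t + δ), P u =
      (Real.arsinh (δ / e) - δ / Real.sqrt (δ ^ 2 + e ^ 2)) •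
        cross (deriv X t) (deriv (deriv X) t) := by
    simp only [hP]
    rw [intervalIntegral.integral_smul_const]
    congr 1
    have h1 := intervalIntegral.integral_comp_sub_right (a := t - δ) (b := t + δ)
      (fun s : ℝ => ((s ^ 2 + e ^ 2) ^ (3 / 2 : ℝ))⁻¹ * (s ^ 2 / 2)) t
    rw [show t - δ - t = -δ by ring, show t + δ - t = δ by ring] at h1
    rw [h1]
    have h2 : (fun s : ℝ => ((s ^ 2 + e ^ 2) ^ (3 / 2 : ℝ))⁻¹ * (s ^ 2 / 2)) =
        fun s : ℝ => 1 / 2 * (s ^ 2 * ((s ^ 2 + e ^ 2) ^ (3 / 2 : ℝ))⁻¹) := by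
      funext s; ring
    rw [h2, intervalIntegral.integral_const_mul, stub_rosenheadMoments.2.2 e δ he hδ.le]
    ring
  -- splitting of the window integral
  have hFi : IntervalIntegrable F volume (t - δ) (t + δ) := hcont.intervalIntegrable _ _
  have hPi : IntervalIntegrable P volume (t - δ) (t + δ) := hPc.intervalIntegrable _ _
  have hwin : ∫ u in (t - δ)..(t + δ), F u =
      (Real.arsinh (δ / e) - δ / Real.sqrt (δ ^ 2 + e ^ 2)) •
          cross (deriv X t) (deriv (deriv X) t) +
        ∫ u in (t - δ)..(t + δ), (F u - P u) := by
    rw [intervalIntegral.integral_sub hFi hPi, hPint]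
    abel
  have hwinB : ‖∫ u in (t - δ)..(t + δ), (F u - P u)‖ ≤ M * (2 * δ) := by
    have h := intervalIntegral.norm_integral_le_of_norm_le_const (a := t - δ) (b := t + δ)
      (C := M) (f := fun u => F u - P u) fun u _ => hptw u
    rwa [show t + δ - (t - δ) = 2 * δ by ring, abs_of_pos (by positivity : (0 : ℝ) < 2 * δ)] at h
  -- whole line = tail + window
  have hsplit : ∫ u, F u =
      (∫ u in {u : ℝ | δ ≤ |u - t|}, F u) + ∫ u in (t - δ)..(t + δ), F u := by
    rw [← integral_add_compl hSm hInt, hSc,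
      intervalIntegral.integral_of_le (show t - δ ≤ t + δ by linarith),
      integral_Ioc_eq_integral_Ioo]
  rw [hsplit, hwin, add_sub_assoc, add_sub_cancel_left]
  exact (norm_add_le _ _).trans (add_le_add htailB hwinB)

end Summit.NavierStokesRegularity.NavierStokesRegularity.Theorems.SkeletonEquilibrium.ZeroAccretionSelection
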